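import Mathlib
import Summits.ValiantsHypothesis.ValiantsHypothesis.Theorems.DivisionGapPerCofactorDegreeReductionStubAdditiveCreation
import Summits.ValiantsHypothesis.ValiantsHypothesis.Theorems.DivisionGapPerCofactorDegreeReductionStubRelationComponents
import Summits.ValiantsHypothesis.ValiantsHypothesis.Theorems.DivisionGapPerCofactorDegreeReductionStubWeightedLineNormalForm
import Summits.ValiantsHypothesis.ValiantsHypothesis.Theorems.DivisionGapPerCofactorDegreeReductionStubSignedBinaryFormRoot

/-!
# Crux `DivisionGap.PerCofactorDegreeReduction` (stmt-ValiantsHypothesis-15046), line `Sketch` —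
# stub `stub_twoClassDependence`: every relation between two homogeneous light gates modulo the
# permanent is carried by the primitive binomial

**Theorem (`stub_twoClassDependence`).** Let `n, e, e' ≥ 1`, let `u, u' ∈ ℝ≥0[x_ij]` (`n × n`
variables) be forms of degrees `e, e'`, not divisible by `per_n` over `ℝ`, and write `U, U'` for
their images in `ℝ[x]`.  If a nonzero `R ∈ ℝ[y₀, y₁]` satisfies `per_n ∣ R(U, U')`, then
`per_n ∣ U^p - μ U'^q` for some real `μ ≠ 0`, where `g = gcd(e, e')`, `p = e'/g`, `q = e/g`.

## Proof

Pure composition of three landed stubs.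
* `R ≠ 0` has a nonzero weighted homogeneous component `R_D` for the weights `(e, e')`: take
  `D` the weight of a monomial in the support (`exists_weightedHomogeneousComponent_ne_zero`).
* Weighted components of relations are relations (`stub_relationComponents`, using that `U, U'`
  are forms of degrees `e, e'`): `per_n ∣ R_D(U, U')`.
* Normal form of a polynomial supported on one weighted line (`stub_weightedLineNormalForm`):
  `R_D = y₀^{a₀} y₁^{b₀} · Σ_{i ≤ N} c_i (y₀^p)^i (y₁^q)^{N-i}` with `c₀ ≠ 0`.
* Substituting (`aeval` is an algebra map): `per_n ∣ U^{a₀} U'^{b₀} · Σ c_i (U^p)^i (U'^q)^{N-i}`;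
  `per_n` is prime (`perPoly_prime`) and divides neither `U^{a₀}` nor `U'^{b₀}`, so it divides the
  binary form.
* A signed binary-form relation between `U^p, U'^q` is binomial (`stub_signedBinaryFormRoot`,
  `p, q ≥ 1`).
-/

noncomputable section

-- `Summit.ValiantsHypothesis.ValiantsHypothesis.…` is the tree's mandated single-conjunct layout
-- (Problem = Summit), so the duplicated namespace component is intended.
set_option linter.dupNamespace false

namespace Summit.ValiantsHypothesis.ValiantsHypothesis.Theorems.DivisionGap.PerCofactorDegreeReduction.TwoClassDependence

open MvPolynomial Literature.Computability.AlgebraicComplexity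
open Summit.ValiantsHypothesis.ValiantsHypothesis.Theorems.DivisionGap.PerCofactorDegreeReduction.AdditiveCreation
  (perPoly_prime)
open Summit.ValiantsHypothesis.ValiantsHypothesis.Theorems.DivisionGap.PerCofactorDegreeReduction.RelationComponents
  (stub_relationComponents)
open Summit.ValiantsHypothesis.ValiantsHypothesis.Theorems.DivisionGap.PerCofactorDegreeReduction.WeightedLineNormalForm
  (stub_weightedLineNormalForm)
open Summit.ValiantsHypothesis.ValiantsHypothesis.Theorems.DivisionGap.PerCofactorDegreeReduction.SignedBinaryFormRoot
  (stub_signedBinaryFormRoot)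
open scoped NNReal BigOperators

/-- A nonzero polynomial has a nonzero weighted homogeneous component (for any weights): the
component of the weight of a monomial of its support. [folklore] -/
theorem exists_weightedHomogeneousComponent_ne_zero {σ K : Type*} [CommSemiring K] (w : σ → ℕ)
    {p : MvPolynomial σ K} (hp : p ≠ 0) :
    ∃ D, weightedHomogeneousComponent w D p ≠ 0 := by
  classical
  obtain ⟨m, hm⟩ := support_nonempty.mpr hp
  refine ⟨Finsupp.weight w m, fun h => mem_support_iff.mp hm ?_⟩
  have := congr_arg (coeff m) h
  rwa [coeff_weightedHomogeneousComponent, if_pos rfl, coeff_zero] at this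

/-- **stub_twoClassDependence — EVERY RELATION BETWEEN TWO HOMOGENEOUS LIGHT GATES MODULO THE
PERMANENT IS CARRIED BY THE PRIMITIVE BINOMIAL.**  For `n, e, e' ≥ 1`, forms
`u, u' ∈ ℝ≥0[x_ij]` of degrees `e, e'` not divisible by `per_n` over `ℝ` (real images `U, U'`),
and a nonzero `R ∈ ℝ[y₀, y₁]` with `per_n ∣ R(U, U')`: `per_n ∣ U^p - μ U'^q` for some real
`μ ≠ 0`, `p = e'/gcd(e,e')`, `q = e/gcd(e,e')`.  Composition of `stub_relationComponents`
(pass to a nonzero weighted component of `R`), `stub_weightedLineNormalForm` (it is a monomial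
times a binary form in `y₀^p, y₁^q`), primality of `per_n` (strip the monomial) and
`stub_signedBinaryFormRoot`. [folklore] -/
theorem stub_twoClassDependence (n e e' : ℕ) (hn : 1 ≤ n) (he : 1 ≤ e) (he' : 1 ≤ e')
    (u u' : MvPolynomial (Fin n × Fin n) ℝ≥0)
    (huh : u.IsHomogeneous e) (hu'h : u'.IsHomogeneous e')
    (hu : ¬ perPoly (Fin n) ℝ ∣ MvPolynomial.map NNReal.toRealHom u)
    (hu' : ¬ perPoly (Fin n) ℝ ∣ MvPolynomial.map NNReal.toRealHom u')
    (R : MvPolynomial (Fin 2) ℝ) (hR : R ≠ 0)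
    (hdvd : perPoly (Fin n) ℝ ∣ MvPolynomial.aeval
      ![MvPolynomial.map NNReal.toRealHom u, MvPolynomial.map NNReal.toRealHom u'] R) :
    ∃ μ : ℝ, μ ≠ 0 ∧ perPoly (Fin n) ℝ ∣
      MvPolynomial.map NNReal.toRealHom u ^ (e' / Nat.gcd e e') -
        C μ * MvPolynomial.map NNReal.toRealHom u' ^ (e / Nat.gcd e e') := by
  classical
  have hprime : Prime (perPoly (Fin n) ℝ) := perPoly_prime hn
  -- (a) a nonzero weighted homogeneous component `R_D` of `R`
  obtain ⟨D, hD⟩ := exists_weightedHomogeneousComponent_ne_zero (![e, e'] : Fin 2 → ℕ) hR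
  -- (b) `per_n ∣ R_D(U, U')`
  have hdvdD := stub_relationComponents n e e' D (MvPolynomial.map NNReal.toRealHom u)
    (MvPolynomial.map NNReal.toRealHom u') (huh.map _) (hu'h.map _) R hdvd
  -- (c) normal form of `R_D`
  obtain ⟨a₀, b₀, N, c, hc0, hRD⟩ := stub_weightedLineNormalForm (K := ℝ) e e' D he he' _ hD
    (weightedHomogeneousComponent_isWeightedHomogeneous D R)
  -- (d) substitute
  rw [hRD] at hdvdD
  simp only [map_mul, map_pow, map_sum, aeval_X, algHom_C, algebraMap_eq, Matrix.cons_val_zero,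
    Matrix.cons_val_one] at hdvdD
  -- (e) strip the monomial `U^{a₀} U'^{b₀}`
  have hsum : perPoly (Fin n) ℝ ∣ ∑ i : Fin (N + 1), C (c i) *
      ((MvPolynomial.map NNReal.toRealHom u ^ (e' / Nat.gcd e e')) ^ (i : ℕ) *
        (MvPolynomial.map NNReal.toRealHom u' ^ (e / Nat.gcd e e')) ^ (N - (i : ℕ))) := by
    rcases hprime.dvd_or_dvd hdvdD with h | h
    · rcases hprime.dvd_or_dvd h with h' | h'
      · exact absurd (hprime.dvd_of_dvd_pow h') hu
      · exact absurd (hprime.dvd_of_dvd_pow h') hu'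
    · exact h
  -- (f) the signed binary-form root
  have hg : 0 < Nat.gcd e e' := Nat.gcd_pos_of_pos_left e' he
  have hp : 1 ≤ e' / Nat.gcd e e' := Nat.div_pos (Nat.le_of_dvd he' (Nat.gcd_dvd_right e e')) hg
  have hq : 1 ≤ e / Nat.gcd e e' := Nat.div_pos (Nat.le_of_dvd he (Nat.gcd_dvd_left e e')) hg
  exact stub_signedBinaryFormRoot n N _ _ hn hp hq u u' hu hu' c
    (fun h => hc0 (by rw [h, Pi.zero_apply])) hsum

end Summit.ValiantsHypothesis.ValiantsHypothesis.Theorems.DivisionGap.PerCofactorDegreeReduction.TwoClassDependence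

end
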